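import Mathlib.RingTheory.MvPolynomial.Homogeneous
import Mathlib.Data.Finsupp.Multiset
import Mathlib.Algebra.Polynomial.Bivariate
import Mathlib.Algebra.Polynomial.BigOperators
import Mathlib.Algebra.MvPolynomial.Eval
import Mathlib.Tactic.IntervalCases
import Mathlib.Analysis.SpecialFunctions.Pow.Real
import HarnessLib

/-!
# Plane sections `f(θ)` of a multivariate polynomial: total degree, `Y`-degree, top coefficient

Bookkeeping for the restriction of `f ∈ A[X₁, …, Xₙ]` (`A` a commutative ring) to a plane
parametrised by affine-linear forms `θᵢ = aᵢ Y + ℓᵢ(X)` (`aᵢ ∈ A`, `ℓᵢ ∈ A[X]` of degree `≤ 1`):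
the plane section `Φ₀ = f(θ₁, …, θₙ) ∈ A[X][Y]` has total degree `≤ δ = deg f`
(`coeff_coeff_aeval_affine_eq_zero`, total degree being spelled
`∀ k j, δ < j + k → coeff of X^j Y^k = 0`), `Y`-degree `≤ δ` (`natDegree_aeval_affine_le`), and
`Y^δ`-coefficient the constant `f_δ(a)`, the top homogeneous component of `f` at the direction `a`
(`coeff_aeval_affine_totalDegree`). Also the numerical fact `δ + (δ-1)(δ-2)√q < q + 1` for
`2δ⁴ < q` (`cast_add_mul_sqrt_lt`). These feed the last step of Cafure–Matera's proof of Thm. 5.4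
(`PlaneSectionRationalPointProofs`) and the shape analysis of the generic plane section in the
Bertini files.

## References

* A. Cafure, G. Matera, Finite Fields Appl. 12 (2006) 155–185, proof of Thm. 5.4. [CafureMatera2006]
-/

noncomputable section

open scoped Classical Polynomial.Bivariate
open Polynomial

namespace Literature.NumberTheory.DiophantineGeometry

universe u

variable {K : Type u} [CommRing K]

/-! ### Total degree bookkeeping in `K[X][Y]` (`K` any commutative ring)

"`P` has total degree `≤ d`" is spelled `∀ k j, d < j + k → (P.coeff k).coeff j = 0`. -/

/-- Total degree is submultiplicative. [folklore] -/
theorem coeff_coeff_mul_eq_zero {P Q : K[X][Y]} {d e : ℕ}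
    (hP : ∀ k j, d < j + k → (P.coeff k).coeff j = 0)
    (hQ : ∀ k j, e < j + k → (Q.coeff k).coeff j = 0) :
    ∀ k j, d + e < j + k → ((P * Q).coeff k).coeff j = 0 := by
  intro k j hjk
  rw [coeff_mul, finsetSum_coeff]
  refine Finset.sum_eq_zero fun x hx ↦ ?_
  rw [Finset.mem_antidiagonal] at hx
  rw [coeff_mul]
  refine Finset.sum_eq_zero fun y hy ↦ ?_
  rw [Finset.mem_antidiagonal] at hy
  by_cases h1 : d < y.1 + x.1
  · rw [hP _ _ h1, zero_mul]
  · have h2 : e < y.2 + x.2 := by omega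
    rw [hQ _ _ h2, mul_zero]

/-- Total degree is subadditive. [folklore] -/
theorem coeff_coeff_add_eq_zero {P Q : K[X][Y]} {d : ℕ}
    (hP : ∀ k j, d < j + k → (P.coeff k).coeff j = 0)
    (hQ : ∀ k j, d < j + k → (Q.coeff k).coeff j = 0) :
    ∀ k j, d < j + k → ((P + Q).coeff k).coeff j = 0 := fun k j h ↦ by
  rw [coeff_add, coeff_add, hP k j h, hQ k j h, add_zero]

/-- Total degree bounds are monotone. [folklore] -/
theorem coeff_coeff_eq_zero_mono {P : K[X][Y]} {d e : ℕ} (hde : d ≤ e)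
    (hP : ∀ k j, d < j + k → (P.coeff k).coeff j = 0) :
    ∀ k j, e < j + k → (P.coeff k).coeff j = 0 := fun k j h ↦ hP k j (by omega)

/-- Constants have total degree `0`. [folklore] -/
theorem coeff_coeff_C_C_eq_zero (c : K) :
    ∀ k j, 0 < j + k → ((C (C c) : K[X][Y]).coeff k).coeff j = 0 := by
  intro k j h
  rw [coeff_C]
  split_ifs with hk
  · subst hk
    rw [coeff_C, if_neg (by omega)]
  · rw [coeff_zero]

/-- `deg_Y (a Y + ℓ(X)) ≤ 1`. [folklore] -/
theorem natDegree_affine_le (a : K) (ℓ : K[X]) : (C (C a) * Y + C ℓ : K[X][Y]).natDegree ≤ 1 := by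
  refine (natDegree_add_le _ _).trans (max_le ?_ ?_)
  · exact (natDegree_C_mul_le _ _).trans natDegree_X_le
  · simp

/-- The `Y`-coefficient of `a Y + ℓ(X)` is `a`. [folklore] -/
theorem coeff_affine_one (a : K) (ℓ : K[X]) : (C (C a) * Y + C ℓ : K[X][Y]).coeff 1 = C a := by
  rw [coeff_add, coeff_C_mul, coeff_X_one, mul_one, coeff_C, if_neg one_ne_zero, add_zero]

/-- An affine-linear form `a Y + ℓ(X)` (`deg ℓ ≤ 1`) has total degree `≤ 1`. [folklore] -/
theorem coeff_coeff_affine_eq_zero (a : K) {ℓ : K[X]} (hℓ : ℓ.natDegree ≤ 1) :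
    ∀ k j, 1 < j + k → ((C (C a) * Y + C ℓ : K[X][Y]).coeff k).coeff j = 0 := by
  intro k j h
  rcases Nat.lt_or_ge 1 k with hk | hk
  · rw [coeff_eq_zero_of_natDegree_lt ((natDegree_affine_le a ℓ).trans_lt hk), coeff_zero]
  · interval_cases k
    · rw [show (C (C a) * Y + C ℓ : K[X][Y]).coeff 0 = ℓ by simp]
      exact coeff_eq_zero_of_natDegree_lt (by omega)
    · rw [coeff_affine_one, coeff_C, if_neg (by omega)]

/-- A product of `N` polynomials of total degree `≤ 1` has total degree `≤ N`. [folklore] -/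
theorem coeff_coeff_multiset_prod_eq_zero (t : Multiset K[X][Y])
    (ht : ∀ P ∈ t, ∀ k j, 1 < j + k → (P.coeff k).coeff j = 0) :
    ∀ k j, Multiset.card t < j + k → ((t.prod).coeff k).coeff j = 0 := by
  induction t using Multiset.induction_on with
  | empty =>
    intro k j h
    rw [Multiset.prod_zero]
    simpa using coeff_coeff_C_C_eq_zero (1 : K) k j (by simpa using h)
  | cons P t ih =>
    intro k j h
    rw [Multiset.prod_cons]
    rw [Multiset.card_cons] at h
    exact coeff_coeff_mul_eq_zero (ht P (Multiset.mem_cons_self _ _))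
      (ih fun Q hQ ↦ ht Q (Multiset.mem_cons_of_mem hQ)) k j (by omega)

/-! ### The plane section `f(θ)` of a multivariate polynomial -/

section Section

variable {n : ℕ}

/-- Expansion of `f(θ)` over the monomials of `f`: `f(θ) = ∑_m f_m · ∏ θᵢ^{mᵢ}`, the product
written as a multiset product. [folklore] -/
theorem aeval_eq_sum_multiset_prod (f : MvPolynomial (Fin n) K) (θ : Fin n → K[X][Y]) :
    MvPolynomial.aeval θ f =
      ∑ m ∈ f.support, C (C (f.coeff m)) * (m.toMultiset.map θ).prod := by
  conv_lhs => rw [f.as_sum]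
  rw [map_sum]
  refine Finset.sum_congr rfl fun m _ ↦ ?_
  rw [MvPolynomial.aeval_monomial, Finsupp.toMultiset_map, Finsupp.prod_toMultiset,
    Finsupp.prod_mapDomain_index (fun _ ↦ pow_zero _) (fun _ _ _ ↦ pow_add _ _ _)]
  rfl

/-- The degree `|m| = ∑ mᵢ` of an exponent vector is the size of its multiset. [folklore] -/
theorem card_toMultiset_eq_degree (m : Fin n →₀ ℕ) :
    Multiset.card m.toMultiset = m.degree := by
  rw [Finsupp.card_toMultiset, Finsupp.degree]
  rfl

/-- **Total degree of a plane section:** `f(θ)` has total degree `≤ deg f` for affine-linear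
`θᵢ = aᵢ Y + ℓᵢ(X)`. [folklore] -/
theorem coeff_coeff_aeval_affine_eq_zero (f : MvPolynomial (Fin n) K) (a : Fin n → K)
    (ℓ : Fin n → K[X]) (hℓ : ∀ i, (ℓ i).natDegree ≤ 1) :
    ∀ k j, f.totalDegree < j + k →
      ((MvPolynomial.aeval (fun i ↦ C (C (a i)) * Y + C (ℓ i)) f).coeff k).coeff j = 0 := by
  intro k j h
  rw [aeval_eq_sum_multiset_prod, finsetSum_coeff, finsetSum_coeff]
  refine Finset.sum_eq_zero fun m hm ↦ ?_
  have hmdeg : Multiset.card (m.toMultiset.map fun i ↦ C (C (a i)) * Y + C (ℓ i)) ≤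
      f.totalDegree := by
    rw [Multiset.card_map, card_toMultiset_eq_degree]
    exact MvPolynomial.le_totalDegree hm
  have hprod := coeff_coeff_multiset_prod_eq_zero
    (m.toMultiset.map fun i ↦ C (C (a i)) * Y + C (ℓ i)) (fun P hP ↦ by
      obtain ⟨i, _, rfl⟩ := Multiset.mem_map.1 hP
      exact coeff_coeff_affine_eq_zero (a i) (hℓ i))
  have h0 := coeff_coeff_mul_eq_zero (coeff_coeff_C_C_eq_zero (f.coeff m)) hprod k j (by omega)
  exact h0

/-- **`Y`-degree of a plane section:** `deg_Y f(θ) ≤ deg f`. [folklore] -/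
theorem natDegree_aeval_affine_le (f : MvPolynomial (Fin n) K) (a : Fin n → K)
    (ℓ : Fin n → K[X]) (hℓ : ∀ i, (ℓ i).natDegree ≤ 1) :
    (MvPolynomial.aeval (fun i ↦ C (C (a i)) * Y + C (ℓ i)) f).natDegree ≤ f.totalDegree := by
  rw [natDegree_le_iff_coeff_eq_zero]
  intro k hk
  ext j
  rw [coeff_zero]
  exact coeff_coeff_aeval_affine_eq_zero f a ℓ hℓ k j (by omega)

/-- `deg_Y ∏ θᵢ^{mᵢ} ≤ |m|` for affine-linear `θᵢ`. [folklore] -/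
theorem natDegree_multiset_prod_affine_le (m : Fin n →₀ ℕ) (a : Fin n → K) (ℓ : Fin n → K[X]) :
    ((m.toMultiset.map fun i ↦ C (C (a i)) * Y + C (ℓ i)).prod).natDegree ≤ m.degree := by
  refine (natDegree_multiset_prod_le _).trans ?_
  have h := Multiset.sum_le_card_nsmul
    ((m.toMultiset.map fun i ↦ C (C (a i)) * Y + C (ℓ i)).map natDegree) 1 (fun x hx ↦ by
      obtain ⟨P, hP, rfl⟩ := Multiset.mem_map.1 hx
      obtain ⟨i, _, rfl⟩ := Multiset.mem_map.1 hP
      exact natDegree_affine_le (a i) (ℓ i))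
  rw [Multiset.card_map, Multiset.card_map, card_toMultiset_eq_degree, smul_eq_mul, mul_one] at h
  exact h

/-- The top `Y`-coefficient of `∏ θᵢ^{mᵢ}` is `∏ aᵢ^{mᵢ}`. [folklore] -/
theorem coeff_multiset_prod_affine_degree (m : Fin n →₀ ℕ) (a : Fin n → K) (ℓ : Fin n → K[X]) :
    ((m.toMultiset.map fun i ↦ C (C (a i)) * Y + C (ℓ i)).prod).coeff m.degree =
      C (m.prod fun i k ↦ a i ^ k) := by
  have h := coeff_multiset_prod_of_natDegree_le
    (t := m.toMultiset.map fun i ↦ C (C (a i)) * Y + C (ℓ i)) 1 (fun P hP ↦ by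
      obtain ⟨i, _, rfl⟩ := Multiset.mem_map.1 hP
      exact natDegree_affine_le (a i) (ℓ i))
  rw [Multiset.card_map, card_toMultiset_eq_degree, mul_one, Multiset.map_map] at h
  rw [h]
  have h2 : ((fun P : K[X][Y] ↦ P.coeff 1) ∘ fun i ↦ C (C (a i)) * Y + C (ℓ i)) =
      fun i ↦ C (a i) := by
    funext i
    exact coeff_affine_one (a i) (ℓ i)
  have h3 : (m.prod fun i k ↦ a i ^ k) = (m.toMultiset.map a).prod := by
    rw [Finsupp.toMultiset_map, Finsupp.prod_toMultiset,
      Finsupp.prod_mapDomain_index (fun _ ↦ pow_zero _) (fun _ _ _ ↦ pow_add _ _ _)]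
  rw [h2, h3, map_multiset_prod, Multiset.map_map]
  rfl

/-- **Top coefficient of a plane section:** the `Y^δ`-coefficient of `f(θ)`, `δ = deg f`, is the
constant `f_δ(a)`, the top homogeneous component of `f` at the `Y`-direction `a`. [folklore] -/
theorem coeff_aeval_affine_totalDegree (f : MvPolynomial (Fin n) K) (a : Fin n → K)
    (ℓ : Fin n → K[X]) :
    (MvPolynomial.aeval (fun i ↦ C (C (a i)) * Y + C (ℓ i)) f).coeff f.totalDegree =
      C (MvPolynomial.eval a (MvPolynomial.homogeneousComponent f.totalDegree f)) := by
  set δ := f.totalDegree with hδ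
  rw [aeval_eq_sum_multiset_prod, finsetSum_coeff, MvPolynomial.homogeneousComponent_apply,
    map_sum, map_sum, ← Finset.sum_filter_add_sum_filter_not f.support (fun m ↦ m.degree = δ)]
  -- the monomials of lower degree do not contribute
  have hlow : ∑ m ∈ f.support.filter (fun m ↦ ¬ m.degree = δ),
      (C (C (f.coeff m)) * ((m.toMultiset.map fun i ↦ C (C (a i)) * Y + C (ℓ i)).prod)).coeff δ
        = 0 := by
    refine Finset.sum_eq_zero fun m hm ↦ ?_
    rw [Finset.mem_filter] at hm
    have hlt : m.degree < δ := lt_of_le_of_ne (MvPolynomial.le_totalDegree hm.1) hm.2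
    rw [coeff_C_mul, coeff_eq_zero_of_natDegree_lt
      ((natDegree_multiset_prod_affine_le m a ℓ).trans_lt hlt), mul_zero]
  rw [hlow, add_zero]
  refine Finset.sum_congr rfl fun m hm ↦ ?_
  rw [Finset.mem_filter] at hm
  rw [coeff_C_mul, ← hm.2, coeff_multiset_prod_affine_degree, ← map_mul, MvPolynomial.eval_monomial]

end Section

/-! ### The numerical condition `δ + (δ-1)(δ-2)√q < q + 1` from `2δ⁴ < q` -/

/-- For `1 ≤ δ` and `2δ⁴ < q`: `δ + (δ-1)(δ-2)√q < q + 1` (Cafure–Matera: "this quantity is a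
strictly positive real number for `q > 2δ⁴`"). [cite: CafureMatera2006, proof of Thm. 5.4] -/
theorem cast_add_mul_sqrt_lt (δ q : ℕ) (hδ : 1 ≤ δ) (hq : 2 * δ ^ 4 < q) :
    (δ : ℝ) + ((δ - 1) * (δ - 2) : ℕ) * √(q : ℝ) < (q : ℝ) + 1 := by
  set s : ℝ := √(q : ℝ) with hs
  have hs0 : 0 ≤ s := Real.sqrt_nonneg _
  have hsq : s ^ 2 = q := Real.sq_sqrt (Nat.cast_nonneg _)
  have hq' : 2 * (δ : ℝ) ^ 4 < q := by exact_mod_cast hq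
  have hd2 : (δ : ℝ) ^ 2 < s := by
    rw [hs, Real.lt_sqrt (by positivity)]
    nlinarith
  rcases Nat.lt_or_ge δ 2 with hδ2 | hδ2
  · have h1 : δ = 1 := by omega
    subst h1
    norm_num
    have : (2 : ℝ) < q := by
      have h := hq'
      norm_num at h
      exact_mod_cast h
    linarith
  · have hcast : (((δ - 1) * (δ - 2) : ℕ) : ℝ) = ((δ : ℝ) - 1) * ((δ : ℝ) - 2) := by
      have h1 : 1 ≤ δ := hδ
      push_cast [Nat.cast_sub h1, Nat.cast_sub hδ2]
      ring
    rw [hcast, ← hsq]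
    have hδr : (2 : ℝ) ≤ δ := by exact_mod_cast hδ2
    have hspos : 0 < s := lt_of_lt_of_le (by positivity) hd2.le
    have h1 : (δ : ℝ) ^ 2 * s < s * s := mul_lt_mul_of_pos_right hd2 hspos
    nlinarith [h1, hd2, hδr, hspos]

end Literature.NumberTheory.DiophantineGeometry
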